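import Summits.QuantumFields.YangMills.Theorems.BalabanUVNodesN15LiveGluedPropagatorIncrementLetter
import Summits.QuantumFields.YangMills.Theorems.BalabanUVNodesN15ColouredUnitBondDictionary
import Summits.QuantumFields.YangMills.Theorems.BalabanUVNodesN15TwoGridAveragingDefect
import Literature.MathematicalPhysics.QuantumFieldTheory.Balaban1983to89.B9Eq3130MatrixLetters
import HarnessLib

/-!
# N15 = NE2 — Σ-col (J-a): THE LIVE BACKGROUND MATRIX `Z(A) = [(Q⊗1)(G(U) − Δ_a⁻¹⊗1)(Q*⊗1)]` ON THE COLOURED UNIT BONDS DECAYS AT SIZE `O(κ_e r_A)`, BOTH SPACINGS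
# (dag-n15-a g28, programme Σ-col, FILE (J-a); node N15 = NE2; `--kind proof --supports stmt-QuantumFields-27366 --as helper`, count-neutral, theorems only, 0 def)

WHY.  The U-live SITE and UNIT layers on dag-n15-c's coloured carrier are Σ-A's ∕ Σ-C's exact dictionaries with Σ-col (G)'s coloured rows: the site object
`(unitBondMatC((Q⊗1)X(U)(Q*⊗1)))⁻¹` is the exact dressing `exDress b (Δpol ⊗ 1) Z` of `Z(U) = unitBondMatC((Q⊗1)(X(U) − G⊗1)(Q*⊗1))` (V-D's identity with colour), and Σ-col (H)
`exDress_deltaCol_letters` wants three letters on `Z`: decay at each spacing ((i),(ii)) and the η-difference ((iii)).  This file supplies (i) and (ii) from FILE (I-b)'s increment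
letter: Bałaban's `Q`, `Q*` keep exponential block majorants (dag-n15-a `hasMaj_qvRe_comp` ∕ `hasMaj_qvAdjRe_comp`, lifted to the colour by N-II `hasMaj_tensorId`), [B11]
`hasMaj_comp_exp` composes, and a block majorant between unit 1-forms blocked by their site IS an entry letter of `unitBondMatC` (§2, the coloured twin of U-B0
`abs_unitBondMat_le_of_hasMaj`).

WHAT.  §1 `hasMaj_tensorId_qvRe` ∕ `hasMaj_tensorId_qvAdjRe` (coloured `Q`, `Q*` letters `e^{ρ}e^{−ρd}`);
§2 `abs_unitBondMatC_le_of_hasMaj`; §3 ★★★ `exists_abs_zc_le`: in FILE 133's regime, at both spacings, `|Z(A)_{pq}| ≤ K·κ_e·r_A·e^{−δ·cdist(p,q)}`.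
Honest label: MODEL objects as FILE 133; operator-side input of the U-live site∕unit layers only ((iii) and the layers themselves are the sequel); no count.
[cite: Balaban1984PropagatorsI, (1.18) p.20, (1.102)–(1.103) p.34; Balaban1984PropagatorsII, (2.51)–(2.56) pp.232–233, (2.156) p.250; Balaban1985BackgroundPropagators, (3.62)–(3.65) pp.402–403]
-/

open scoped BigOperators Matrix Matrix.Norms.Frobenius

namespace Summit.QuantumFields.YangMills.BalabanUVNodes.N15.GluedZeroField

open Literature.MathematicalPhysics.QuantumFieldTheory.Balaban1983to89
open Literature.MathematicalPhysics.QuantumFieldTheory.Balaban1983to89.B5Prop11Plancherel (Tor fine)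
open Literature.MathematicalPhysics.QuantumFieldTheory.Balaban1983to89.B11SectG (BlockNorm HasMaj RowSum hasMaj_comp_exp)
open Literature.MathematicalPhysics.QuantumFieldTheory.Balaban1983to89.B11AxialTransport190 (loc_ofBlocks_le abs_le_loc_ofBlocks)
open Literature.MathematicalPhysics.QuantumFieldTheory.Balaban1983to89.B9Eq3130MatrixLetters (hasMaj_id_ofBlocks)
open Literature.MathematicalPhysics.QuantumFieldTheory.Balaban1983to89.B6UnitTorusCarrier (unitTorusGeo unitTorusGeo_dist_nonneg unitTorusGeo_dist_self triangle254_unitTorusGeo rowSum_unitTorusGeo)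
open Literature.MathematicalPhysics.QuantumFieldTheory.Balaban1983to89.B6Lemma24Torus (pbox)
open Literature.MathematicalPhysics.QuantumFieldTheory.King1986.Torus (blockOf tdistT)
open Literature.Barriers.QuantumFields (traceForm)
open Summit.QuantumFields.YangMills.BalabanUVNodes.N15.BackgroundLayer (gavgM)
open Summit.QuantumFields.YangMills.BalabanUVNodes.N15.BackgroundModel (kappa_ofBlocks)
open Summit.QuantumFields.YangMills.BalabanUVNodes.N15.VectorPiece (bshiftEquiv kingPrV tensorId tensorId_apply hasMaj_tensorId)
open Summit.QuantumFields.YangMills.BalabanUVNodes.N15.MatrixSpecies (basisConst basisConst_nonneg liftBlk)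
open Summit.QuantumFields.YangMills.BalabanUVNodes.N15.TwoGrid (gOp qvRe qvAdjRe hasMaj_qvRe_comp hasMaj_qvAdjRe_comp)
open Summit.QuantumFields.YangMills.BalabanUVNodes.N15.UnitLayerBg (boxBondTor pdist_eq_tdistT_boxBondTor)
open Summit.QuantumFields.YangMills.BalabanUVNodes.N15.UnitLayerBgCol (unitBondMatC cdist cdist_eq)
open Summit.QuantumFields.YangMills.BalabanUVNodes.N15.Gluing (cvM CvX CvX' cvBlk CvNorm cvNL cvNL' cvGlued cvGlued')

variable {d : ℕ}

/-! ## §1 Bałaban's `Q`, `Q*` tensored with the colour keep exponential block majorants (lit `hasMaj_id_ofBlocks` + part 45 + N-II `hasMaj_tensorId`) -/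

section Q

variable {L : ℕ} (M : Fin (d + 1) → ℕ) [∀ μ, NeZero (M μ)] (k n : ℕ) [NeZero n] (ι : Type) [Fintype ι]

/-- ★ **`Q ⊗ 1_ι` KEEPS EXPONENTIAL BLOCK MAJORANTS**: `HasMaj (fine 1-forms ⊗ ι, King's blocks) (unit 1-forms ⊗ ι, by site) (Q ⊗ 1_ι) (e^{ρ}·e^{−ρd})`, `ρ ≥ 0`
(dag-n15-a `hasMaj_qvRe_comp` at the identity, N-II `hasMaj_tensorId`). [cite: Balaban1984PropagatorsI, (1.18) p.20] -/
theorem hasMaj_tensorId_qvRe {ρ : ℝ} (hρ : 0 ≤ ρ) :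
    HasMaj (BlockNorm.ofBlocks (unitTorusGeo L k M) (liftBlk (fun i : Tor (fine n M) × Fin (d + 1) => blockOf n M i.1) ι))
      (BlockNorm.ofBlocks (unitTorusGeo L k M) (liftBlk (fun b : Tor M × Fin (d + 1) => b.1) ι)) (tensorId ι (qvRe M n))
      (fun y y' => 1 * Real.exp ρ * Real.exp (-(ρ * tdistT M y y'))) := by
  have h := hasMaj_qvRe_comp M k n zero_le_one hρ (hasMaj_id_ofBlocks (g := unitTorusGeo L k M) (fun i : Tor (fine n M) × Fin (d + 1) => blockOf n M i.1)
    (unitTorusGeo_dist_self L k M) ρ)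
  rw [LinearMap.comp_id] at h
  exact hasMaj_tensorId ι (fun y y' => by positivity) h

/-- ★ **`Q* ⊗ 1_ι` KEEPS EXPONENTIAL BLOCK MAJORANTS**: `HasMaj (unit 1-forms ⊗ ι, by site) (fine 1-forms ⊗ ι, King's blocks) (Q* ⊗ 1_ι) (e^{ρ}·e^{−ρd})`, `ρ ≥ 0`.
[cite: Balaban1984PropagatorsI, (1.18) p.20 (the stencil of Q*)] -/
theorem hasMaj_tensorId_qvAdjRe {ρ : ℝ} (hρ : 0 ≤ ρ) :
    HasMaj (BlockNorm.ofBlocks (unitTorusGeo L k M) (liftBlk (fun b : Tor M × Fin (d + 1) => b.1) ι))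
      (BlockNorm.ofBlocks (unitTorusGeo L k M) (liftBlk (fun i : Tor (fine n M) × Fin (d + 1) => blockOf n M i.1) ι)) (tensorId ι (qvAdjRe M n))
      (fun y y' => 1 * Real.exp ρ * Real.exp (-(ρ * tdistT M y y'))) := by
  have h := hasMaj_qvAdjRe_comp M k n zero_le_one hρ (hasMaj_id_ofBlocks (g := unitTorusGeo L k M) (fun b : Tor M × Fin (d + 1) => b.1) (unitTorusGeo_dist_self L k M) ρ)
  rw [LinearMap.comp_id] at h
  exact hasMaj_tensorId ι (fun y y' => by positivity) h

end Q

/-! ## §2 A block majorant between coloured unit 1-forms blocked by their site is an entry letter of `unitBondMatC` -/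

section Entry

variable {L : ℕ} (M : Fin (d + 1) → ℕ) [∀ μ, NeZero (M μ)] (k : ℕ) (ι : Type) [Fintype ι] [DecidableEq ι]

/-- ★ **SHARP-BLOCK MAJORANT ⇒ COLOURED ENTRY LETTER**: `T ≤ B·e^{−δ|y−y′|_T}` (coloured unit 1-forms blocked by their site) ⟹ `|unitBondMatC T ((b,i),(b′,i′))| ≤ B·e^{−δ·cdist}`
— the test function `δ_{(b′,i′)}` is localised at the site of `b′` with size `1` (U-B0 `abs_unitBondMat_le_of_hasMaj` with colour). [cite: Balaban1984PropagatorsII, (2.51) p.232 (block majorant: shape)] -/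
theorem abs_unitBondMatC_le_of_hasMaj {T : ((Tor M × Fin (d + 1)) × ι → ℝ) →ₗ[ℝ] ((Tor M × Fin (d + 1)) × ι → ℝ)} {B δ : ℝ} (hB : 0 ≤ B)
    (h : HasMaj (BlockNorm.ofBlocks (unitTorusGeo L k M) (liftBlk (fun bb : Tor M × Fin (d + 1) => bb.1) ι))
      (BlockNorm.ofBlocks (unitTorusGeo L k M) (liftBlk (fun bb : Tor M × Fin (d + 1) => bb.1) ι)) T (fun y y' => B * Real.exp (-(δ * tdistT M y y'))))
    (p q : B4.Idx (pbox M) (d + 1) × ι) :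
    |unitBondMatC M ι T p q| ≤ B * Real.exp (-(δ * cdist M ι p q)) := by
  classical
  rw [cdist_eq, pdist_eq_tdistT_boxBondTor]
  unfold unitBondMatC
  rw [LinearMap.toMatrix'_apply]
  have hloc : (BlockNorm.ofBlocks (unitTorusGeo L k M) (liftBlk (fun bb : Tor M × Fin (d + 1) => bb.1) ι)).IsLoc (boxBondTor M q.1).1
      (Pi.single (boxBondTor M q.1, q.2) (1 : ℝ) : (Tor M × Fin (d + 1)) × ι → ℝ) := by
    intro x hx
    have hne : x ≠ (boxBondTor M q.1, q.2) := fun h => hx (h ▸ rfl)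
    simp [hne]
  have hsize : (BlockNorm.ofBlocks (unitTorusGeo L k M) (liftBlk (fun bb : Tor M × Fin (d + 1) => bb.1) ι)).loc (boxBondTor M q.1).1
      (Pi.single (boxBondTor M q.1, q.2) (1 : ℝ) : (Tor M × Fin (d + 1)) × ι → ℝ) ≤ 1 :=
    loc_ofBlocks_le (g := unitTorusGeo L k M) (liftBlk (fun bb : Tor M × Fin (d + 1) => bb.1) ι) _ zero_le_one fun x _ => by
      by_cases hx : x = (boxBondTor M q.1, q.2)
      · subst hx; simp
      · simp [hx]
  have hmain := h (boxBondTor M q.1).1 _ hloc (boxBondTor M p.1).1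
  have hpt := abs_le_loc_ofBlocks (g := unitTorusGeo L k M) (liftBlk (fun bb : Tor M × Fin (d + 1) => bb.1) ι) (T (Pi.single (boxBondTor M q.1, q.2) 1))
    (x' := (boxBondTor M p.1, p.2)) rfl
  have hK : 0 ≤ B * Real.exp (-(δ * tdistT M (boxBondTor M p.1).1 (boxBondTor M q.1).1)) := mul_nonneg hB (Real.exp_nonneg _)
  calc |T (Pi.single (boxBondTor M q.1, q.2) 1) (boxBondTor M p.1, p.2)|
      ≤ (BlockNorm.ofBlocks (unitTorusGeo L k M) (liftBlk (fun bb : Tor M × Fin (d + 1) => bb.1) ι)).loc (boxBondTor M p.1).1 (T (Pi.single (boxBondTor M q.1, q.2) 1)) := hpt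
    _ ≤ B * Real.exp (-(δ * tdistT M (boxBondTor M p.1).1 (boxBondTor M q.1).1)) *
          (BlockNorm.ofBlocks (unitTorusGeo L k M) (liftBlk (fun bb : Tor M × Fin (d + 1) => bb.1) ι)).loc (boxBondTor M q.1).1
            (Pi.single (boxBondTor M q.1, q.2) (1 : ℝ) : (Tor M × Fin (d + 1)) × ι → ℝ) := hmain
    _ ≤ B * Real.exp (-(δ * tdistT M (boxBondTor M p.1).1 (boxBondTor M q.1).1)) * 1 := mul_le_mul_of_nonneg_left hsize hK
    _ = _ := mul_one _

end Entry

/-! ## §3 The live background matrix decays at size `O(κ_e r_A)`, both spacings -/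

section Live

variable {L : ℕ} [NeZero L]

set_option maxHeartbeats 800000 in
/-- ★★★ **`|Z(A)_{pq}| ≤ K·κ_e·r_A·e^{−δ·cdist(p,q)}` AT BOTH SPACINGS** — letters (i) and (ii) of Σ-col (H) `exDress_deltaCol_letters` for the LIVE background matrix
`Z(A) = unitBondMatC((Q⊗1)(X(A) − G⊗1)(Q*⊗1))` of dag-n15-c's glued covariant propagator, in FILE 133's regime; `K, δ, w₀, R₀` from `d, L, a, ι` only.  (FILE (I-b)'s
increment letter composed with §1's `Q⊗1`, `Q*⊗1` letters by [B11] `hasMaj_comp_exp` — margin a quarter of (I-b)'s rate at each step — read as entries by §2.)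
[cite: Balaban1984PropagatorsI, (1.18) p.20, (1.102)–(1.103) p.34; Balaban1984PropagatorsII, (2.52)–(2.56) pp.232–233; Balaban1985BackgroundPropagators, (3.62)–(3.65) pp.402–403] -/
theorem exists_abs_zc_le (hL : Odd L ∧ 1 < L) (hL7 : 7 ≤ L) {a : ℝ} (ha : 0 < a) (ι : Type) [Fintype ι] [DecidableEq ι] [Nonempty ι] :
    ∃ δ w₀ R₀ K : ℝ, 0 < δ ∧ 0 < R₀ ∧ 0 < K ∧
      ∀ (mv kk r : ℕ), 1 ≤ kk → w₀ ≤ ((L ^ mv : ℕ) : ℝ) →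
      ∀ {mm : Type} [Fintype mm] [DecidableEq mm] (e : Matrix mm mm ℂ ≃L[ℝ] (ι → ℝ)), (∀ A B : Matrix mm mm ℂ, traceForm A B = e A ⬝ᵥ e B) →
      ∀ (A' : Fin (d + 1) → CvX' d L mv kk r hL → Matrix mm mm ℂ), (∀ μ x', (A' μ x')ᴴ = -A' μ x') →
      ∀ (rA : ℝ), 0 ≤ rA → (∀ μ x', ‖A' μ x'‖ ≤ rA) →
        (∀ μ κ x', ‖A' μ (bshiftEquiv (cvM d L mv kk hL) (L ^ r * L ^ kk) κ x') - A' μ x'‖ ≤ rA * ((((L ^ r * L ^ kk : ℕ) : ℝ))⁻¹)) →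
        (∀ μ κ x', ‖(A' μ (bshiftEquiv (cvM d L mv kk hL) (L ^ r * L ^ kk) κ x') - A' μ x') -
            (A' μ (bshiftEquiv (cvM d L mv kk hL) (L ^ r * L ^ kk) κ ((bshiftEquiv (cvM d L mv kk hL) (L ^ r * L ^ kk) μ).symm x')) -
              A' μ ((bshiftEquiv (cvM d L mv kk hL) (L ^ r * L ^ kk) μ).symm x'))‖ ≤ rA * ((((L ^ r * L ^ kk : ℕ) : ℝ))⁻¹) * ((((L ^ r * L ^ kk : ℕ) : ℝ))⁻¹)) →
        2 * ((1 + Fintype.card (Fin (d + 1))) * ((3 + 2 * ((d : ℝ) + 1)) * rA)) ≤ 1 →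
        (14 * Real.exp 1 * (1 + Fintype.card (Fin (d + 1))) * basisConst e * ((1 + Fintype.card (Fin (d + 1))) * ((3 + 2 * ((d : ℝ) + 1)) * rA))) * (1 + Fintype.card (Fin (d + 1) ⊕ Fin (d + 1))) ≤ R₀ →
        (∀ p q, |unitBondMatC (cvM d L mv kk hL) ι
            (tensorId ι (qvRe (cvM d L mv kk hL) (L ^ kk)) ∘ₗ
              (cvGlued d L mv kk hL a ((((L ^ kk : ℕ) : ℝ))⁻¹) ι e (fun _ _ => (1 : Matrix mm mm ℂ))
                  (fun μ x => NormedSpace.exp (((((L ^ kk : ℕ) : ℝ))⁻¹) • gavgM (Matrix mm mm ℂ) (Fin (d + 1)) (kingPrV L kk r (cvM d L mv kk hL)) A' μ x)) (cvNL d L mv kk hL a ι) (fun _ => 0) -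
                tensorId ι (gOp (cvM d L mv kk hL) (L ^ kk) a)) ∘ₗ
              tensorId ι (qvAdjRe (cvM d L mv kk hL) (L ^ kk))) p q| ≤ K * basisConst e * rA * Real.exp (-(δ * cdist (cvM d L mv kk hL) ι p q))) ∧
        (∀ p q, |unitBondMatC (cvM d L mv kk hL) ι
            (tensorId ι (qvRe (cvM d L mv kk hL) (L ^ r * L ^ kk)) ∘ₗ
              (cvGlued' d L mv kk r hL a ((((L ^ r * L ^ kk : ℕ) : ℝ))⁻¹) ι e (fun _ _ => (1 : Matrix mm mm ℂ)) (fun μ x' => NormedSpace.exp (((((L ^ r * L ^ kk : ℕ) : ℝ))⁻¹) • A' μ x'))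
                  (cvNL' d L mv kk r hL a ι) (fun _ => 0) -
                tensorId ι (gOp (cvM d L mv kk hL) (L ^ r * L ^ kk) a)) ∘ₗ
              tensorId ι (qvAdjRe (cvM d L mv kk hL) (L ^ r * L ^ kk))) p q| ≤ K * basisConst e * rA * Real.exp (-(δ * cdist (cvM d L mv kk hL) ι p q))) := by
  have hLpos : 0 < L := Nat.pos_of_ne_zero (NeZero.ne L)
  obtain ⟨δ₁, w₀, R₀, K₁, hδ₁, hR₀, hK₁, H⟩ := exists_hasMaj_cvGlued_sub_tensorId_gOp (d := d) hL hL7 ha ι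
  -- rates: ρ₁ = δ₁ (the `Q*` letter, exact rate), first composition to `δ₁∕2` (margin `δ₁∕2`), the `Q` letter at rate `δ₁∕2`, second composition to `δ₁∕4` (margin `δ₁∕4`)
  have hσ₂ : 0 < δ₁ / 2 := by positivity
  have hσ₄ : 0 < δ₁ / 4 := by positivity
  set c₂ : ℝ := B4Sect5Proof.latticeConst (d + 1) (δ₁ / 2) + 1 with hc₂
  set c₄ : ℝ := B4Sect5Proof.latticeConst (d + 1) (δ₁ / 4) + 1 with hc₄
  have hc₂0 : 0 < c₂ := by have := B4Sect5Proof.latticeConst_nonneg (d + 1) hσ₂.le; rw [hc₂]; linarith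
  have hc₄0 : 0 < c₄ := by have := B4Sect5Proof.latticeConst_nonneg (d + 1) hσ₄.le; rw [hc₄]; linarith
  refine ⟨δ₁ / 4, w₀, R₀, Real.exp (δ₁ / 2) * (K₁ * Real.exp δ₁ * c₂) * c₄, hσ₄, hR₀, by positivity, fun mv kk r hk hw₀ => ?_⟩
  intro mm _ _ e he A' hA' rA hrA h1 h2 h3 hr2 hRle
  obtain ⟨hI, hI'⟩ := H mv kk r hk hw₀ e he A' hA' rA hrA h1 h2 h3 hr2 hRle
  set M := cvM d L mv kk hL with hM
  have hκ0 : 0 ≤ basisConst e := basisConst_nonneg e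
  have htri := triangle254_unitTorusGeo L kk M
  have hd := fun y y' => unitTorusGeo_dist_nonneg L kk M y y'
  have hrow₂ : RowSum (unitTorusGeo L kk M) (δ₁ / 2) c₂ := fun y => (rowSum_unitTorusGeo L kk M hσ₂ y).trans (by rw [hc₂]; linarith)
  have hrow₄ : RowSum (unitTorusGeo L kk M) (δ₁ / 4) c₄ := fun y => (rowSum_unitTorusGeo L kk M hσ₄ y).trans (by rw [hc₄]; linarith)
  constructor
  · intro p q
    -- `(X − G⊗1) ∘ (Q*⊗1)` at rate `δ₁∕2`, then `(Q⊗1) ∘ …` at rate `δ₁∕4`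
    have hA := hasMaj_tensorId_qvAdjRe (L := L) M kk (L ^ kk) ι hδ₁.le
    have h1 := hasMaj_comp_exp (ρ := δ₁ / 2) (σ := δ₁ / 2) htri hd hrow₂ (by positivity) (by positivity) hσ₂.le (by linarith) (by linarith) hI hA
    have hQ := hasMaj_tensorId_qvRe (L := L) M kk (L ^ kk) ι hσ₂.le
    have h2 := hasMaj_comp_exp (ρ := δ₁ / 4) (σ := δ₁ / 4) htri hd hrow₄ (by positivity)
      (mul_nonneg (mul_nonneg (mul_nonneg (BlockNorm.κ_nonneg _) (by positivity)) (by positivity)) hc₂0.le) hσ₄.le (by linarith) (by linarith) hQ h1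
    rw [← LinearMap.comp_assoc] at h2
    have hB0 : 0 ≤ Real.exp (δ₁ / 2) * (K₁ * Real.exp δ₁ * c₂) * c₄ * basisConst e * rA := by positivity
    exact abs_unitBondMatC_le_of_hasMaj M kk ι (B := Real.exp (δ₁ / 2) * (K₁ * Real.exp δ₁ * c₂) * c₄ * basisConst e * rA) (δ := δ₁ / 4) hB0
      (h2.mono fun y y' => le_of_eq (by rw [kappa_ofBlocks]; ring)) p q
  · intro p q
    have hA := hasMaj_tensorId_qvAdjRe (L := L) M kk (L ^ r * L ^ kk) ι hδ₁.le
    have h1 := hasMaj_comp_exp (ρ := δ₁ / 2) (σ := δ₁ / 2) htri hd hrow₂ (by positivity) (by positivity) hσ₂.le (by linarith) (by linarith) hI' hA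
    have hQ := hasMaj_tensorId_qvRe (L := L) M kk (L ^ r * L ^ kk) ι hσ₂.le
    have h2 := hasMaj_comp_exp (ρ := δ₁ / 4) (σ := δ₁ / 4) htri hd hrow₄ (by positivity)
      (mul_nonneg (mul_nonneg (mul_nonneg (BlockNorm.κ_nonneg _) (by positivity)) (by positivity)) hc₂0.le) hσ₄.le (by linarith) (by linarith) hQ h1
    rw [← LinearMap.comp_assoc] at h2
    have hB0 : 0 ≤ Real.exp (δ₁ / 2) * (K₁ * Real.exp δ₁ * c₂) * c₄ * basisConst e * rA := by positivity
    exact abs_unitBondMatC_le_of_hasMaj M kk ι (B := Real.exp (δ₁ / 2) * (K₁ * Real.exp δ₁ * c₂) * c₄ * basisConst e * rA) (δ := δ₁ / 4) hB0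
      (h2.mono fun y y' => le_of_eq (by rw [kappa_ofBlocks]; ring)) p q

end Live

end Summit.QuantumFields.YangMills.BalabanUVNodes.N15.GluedZeroField
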